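import Summits.ResolutionOfSingularities.ResolutionOfSingularities.Theorems.RadicialJungCleanModelsF75cCurveStep
import Literature.AlgebraicGeometry.Resolution.PointBlowupIntersectionMultiplicity
import Literature.AlgebraicGeometry.Resolution.CurveConfigurationMultiplicity
import HarnessLib

/-!
# [F-75c discharge, brick C2] The successor rule: the exceptional curve is transverse to the strict transforms of
# the curves regular at the blown-up point (The Stacks Project, Lemma 54.15.3 (2) = Tag 0BI7; Lemma 54.15.6 = Tag 0BIC, ¶2)

Cell res-hironaka, D-0154 INPUTS discharger `res-inputs-p-f75c` for the named fact F-75c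
`Literature.AlgebraicGeometry.Resolution.Stacks0BIC_embeddedResolutionCurvesInSurfaces_locus`
(`--supports stmt-ResolutionOfSingularities-15917 --as helper`). Printed (Tag 0BI7 (2)): «`Y'` meets the exceptional
fibre `E ⊂ X'` in one point `q` and `m_q(Y' ∩ E) = 1`»; used in Tag 0BIC ¶2: «note that the "new" invariants
`m_{q_i}(Y'_i ∩ E)` are always `1`». This is exactly the successor rule `hnext` of the tree's termination theorem
`false_of_badPointChain_of_curveConfiguration` (`EmbeddedCurveConfigurationPointBlowups.lean`): a new member (the
exceptional curve) is regular and transverse, at every common point, to every other member except possibly the strict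
transforms of the curves singular at the centre.

* `sup_stalkIdeal_exceptional_strictTransform_eq_maximalIdeal` — for an integral one-dimensional reduced curve `C ∋ x`
  REGULAR at `x`, at every point of `E ∩ cl(π⁻¹(C ∖ {x}))`: `𝓘_{E,q} + 𝓘_{C',q} = 𝔪_q` (from the tree's PROVED
  `Stacks0BI7_intersectionMultiplicityDrop_holds`);
* `successor_rule` — the `hnext` clause for the successor configuration `{cl(π⁻¹(C ∖ {x})) : C ∈ 𝒞} ∪ {E}`.

HONEST FRAMING: bookkeeping over tree theorems; nothing here is a statement of [Hironaka2017]. AI-written; AI review is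
weaker than expert review. References: The Stacks Project, Tags 0BI7, 0BIC [StacksProject].
-/

noncomputable section

set_option linter.dupNamespace false -- mandated namespace of this single-conjunct summit

open CategoryTheory AlgebraicGeometry TopologicalSpace IsLocalRing

namespace Summit.ResolutionOfSingularities.ResolutionOfSingularities.Theorems

namespace F75c

open Literature.AlgebraicGeometry.Resolution
open Literature.AlgebraicGeometry.Resolution.CurveConfiguration
open Summit.ResolutionOfSingularities.ResolutionOfSingularities.Theorems.CP2008Prop44
open Scheme.IdealSheafData

universe u

variable {Y Y' : Scheme.{u}} [IsLocallyNoetherian Y] [IsLocallyNoetherian Y'] {x : Y} {hx : IsClosed ({x} : Set Y)}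
  {π : Y' ⟶ Y}

/-- **Tag 0BI7 (2) in the configuration's vocabulary**: for the blowing up `π` of the regular locally Noetherian `Y`
in the closed point `x`, an integral one-dimensional reduced curve `C ∋ x` (`V(𝓘_C)` integral of dimension `1`) which
is REGULAR at `x` (no singular point of `V(𝓘_C)` over `x`), the exceptional curve `E = π⁻¹{x}` and the strict
transform `C' = cl(π⁻¹(C ∖ {x}))` satisfy `𝓘_{E,q} + 𝓘_{C',q} = 𝔪_q` at every common point `q`.
[cite: StacksProject, Tag 0BI7 (Lemma 54.15.3 (2))] [cite: StacksProject, Tag 0BIC (Lemma 54.15.6, proof ¶2)] -/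
theorem sup_stalkIdeal_exceptional_strictTransform_eq_maximalIdeal (hreg : Scheme.IsRegular Y)
    (hπ : IsBlowup π (vanishingIdeal ⟨{x}, hx⟩)) (C : Closeds Y) [IsIntegral (vanishingIdeal C).subscheme]
    (hdim : topologicalKrullDim (vanishingIdeal C).subscheme = 1) (hxC : x ∈ (C : Set Y))
    (hregx : x ∉ (vanishingIdeal C).subschemeι '' (Scheme.regularLocus (vanishingIdeal C).subscheme)ᶜ)
    {q : Y'} (hqE : q ∈ π ⁻¹' {x}) (hqC : q ∈ closure (π ⁻¹' ((C : Set Y) \ {x}))) :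
    stalkIdeal (vanishingIdeal (⟨π ⁻¹' {x}, hx.preimage π.continuous⟩ : Closeds Y')) q ⊔
        stalkIdeal (vanishingIdeal (⟨closure (π ⁻¹' ((C : Set Y) \ {x})), isClosed_closure⟩ : Closeds Y')) q =
      maximalIdeal (Y'.presheaf.stalk q) := by
  -- the point of `V(𝓘_C)` over `x`, regular
  obtain ⟨c, hc⟩ := exists_subschemeι_eq C hxC
  have hregc : IsRegularLocalRing ((vanishingIdeal C).subscheme.presheaf.stalk c) := by
    by_contra h
    exact hregx ⟨c, h, hc⟩
  have hxJ : x ∈ (vanishingIdeal (⟨{x}, hx⟩ : Closeds Y)).support := by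
    rw [← SetLike.mem_coe, Scheme.IdealSheafData.coe_support_vanishingIdeal]; exact Set.mem_singleton x
  have hηJ := subschemeι_genericPoint_notMem_singleton C hdim hx hc
  obtain ⟨-, q₀, hq₀, hlen, -⟩ := Stacks0BI7_intersectionMultiplicityDrop_holds Y (vanishingIdeal C).subscheme
    (vanishingIdeal C).subschemeι (vanishingIdeal ⟨{x}, hx⟩) x hx c hdim hc hregc hxJ
    (fun h => hηJ h) Y' π hπ
  -- identify the ideals: `σ(𝓘_C) = 𝓘_{C'}`, `𝓘_x·𝒪 = 𝓘_E`
  have hker : (vanishingIdeal C).subschemeι.ker = vanishingIdeal C := Scheme.IdealSheafData.ker_subschemeι _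
  have hst : strictTransformIdeal π (vanishingIdeal ⟨{x}, hx⟩) (vanishingIdeal C) =
      vanishingIdeal ⟨closure (π ⁻¹' ((C : Set Y) \ {x})), isClosed_closure⟩ :=
    strictTransformIdeal_vanishingIdeal_eq hπ C hdim
  have hE : (vanishingIdeal ⟨{x}, hx⟩).comap π = vanishingIdeal ⟨π ⁻¹' {x}, hx.preimage π.continuous⟩ :=
    comap_vanishingIdeal_singleton_eq hreg hπ
  rw [hker, hst] at hq₀ hlen
  rw [hE] at hlen
  -- `q = q₀`
  have hq : q = q₀ := by
    have : q ∈ ((vanishingIdeal (⟨closure (π ⁻¹' ((C : Set Y) \ {x})), isClosed_closure⟩ : Closeds Y')).support :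
        Set Y') ∩ π ⁻¹' {x} := by
      rw [Scheme.IdealSheafData.coe_support_vanishingIdeal]
      exact ⟨hqC, hqE⟩
    rw [hq₀] at this
    exact this
  subst hq
  rw [sup_comm]
  exact (length_stalk_quotient_sup_eq_one_iff _ _ q).mp hlen

omit [IsLocallyNoetherian Y] in
/-- **The successor rule `hnext` of `false_of_badPointChain_of_curveConfiguration` for a configuration of
members on a regular surface** (Stacks 0BIC ¶2: the exceptional curve is regular and meets the strict transform of a
curve regular at the centre transversally; two strict transforms are strict transforms). For the blowing up `π` of `Y`
(Noetherian, regular, quasi-excellent, `dim ≤ 2`) in a closed point `x` lying on a member of `𝒞` (members: `cl{η}`, `η`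
not closed, `dim 𝒪_{Y,η} = 1`), every member `C'` of `{cl(π⁻¹(C ∖ {x})) : C ∈ 𝒞} ∪ {π⁻¹{x}}` is a strict transform or
is regular and transverse to every other member except the strict transforms of the curves singular at `x`.
[cite: StacksProject, Tag 0BIC (Lemma 54.15.6, proof ¶1–¶2)] [cite: StacksProject, Tag 0BI7 (Lemma 54.15.3 (2))] -/
theorem successor_rule [IsNoetherian Y] (hreg : Scheme.IsRegular Y) (hqe : Scheme.IsQuasiExcellent Y)
    (hY2 : topologicalKrullDim Y ≤ 2) (hπ : IsBlowup π (vanishingIdeal ⟨{x}, hx⟩)) {𝒞 : Set (Closeds Y)}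
    (hmem : ∀ C ∈ 𝒞, ∃ η : Y, (C : Set Y) = closure {η} ∧ ¬ IsClosed ({η} : Set Y) ∧
      ringKrullDim (Y.presheaf.stalk η) = 1)
    (C' : Closeds Y')
    (hC' : C' ∈ (fun C : Closeds Y => (⟨closure (π ⁻¹' ((C : Set Y) \ {x})), isClosed_closure⟩ : Closeds Y')) '' 𝒞 ∪
      {⟨π ⁻¹' {x}, hx.preimage π.continuous⟩}) :
    (∃ C ∈ 𝒞, (C' : Set Y') = closure (π ⁻¹' ((C : Set Y) \ {x}))) ∨
      (Scheme.IsRegular (vanishingIdeal C').subscheme ∧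
        ∀ D ∈ (fun C : Closeds Y => (⟨closure (π ⁻¹' ((C : Set Y) \ {x})), isClosed_closure⟩ : Closeds Y')) '' 𝒞 ∪
            {⟨π ⁻¹' {x}, hx.preimage π.continuous⟩}, D ≠ C' →
          (¬ ∃ C ∈ 𝒞, (D : Set Y') = closure (π ⁻¹' ((C : Set Y) \ {x})) ∧
              x ∈ (vanishingIdeal C).subschemeι '' (Scheme.regularLocus (vanishingIdeal C).subscheme)ᶜ) →
          ∀ q ∈ (C' : Set Y') ∩ (D : Set Y'),
            stalkIdeal (vanishingIdeal C') q ⊔ stalkIdeal (vanishingIdeal D) q =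
              maximalIdeal (Y'.presheaf.stalk q)) := by
  rcases hC' with ⟨C, hC, rfl⟩ | hC'
  · exact Or.inl ⟨C, hC, rfl⟩
  · rw [Set.mem_singleton_iff] at hC'
    subst hC'
    refine Or.inr ⟨isRegular_subscheme_exceptional hreg hπ, fun D hD hDE hnot q hq => ?_⟩
    rcases hD with ⟨C, hC, rfl⟩ | hD
    swap
    · exact absurd (Set.mem_singleton_iff.mp hD) hDE
    -- `D` is the strict transform of the member `C`, regular at `x` if `x ∈ C`
    obtain ⟨η, hCη, hηcl, hη1⟩ := hmem C hC
    have hCeq : C = ⟨closure {η}, isClosed_closure⟩ := Closeds.ext hCη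
    obtain ⟨hint, -, -, hdim1⟩ := member_props hqe hY2 hη1 hηcl
    rw [← hCeq] at hint hdim1
    haveI := hint
    by_cases hxC : x ∈ (C : Set Y)
    · have hregx : x ∉ (vanishingIdeal C).subschemeι '' (Scheme.regularLocus (vanishingIdeal C).subscheme)ᶜ :=
        fun h => hnot ⟨C, hC, rfl, h⟩
      exact sup_stalkIdeal_exceptional_strictTransform_eq_maximalIdeal hreg hπ C hdim1 hxC hregx hq.1 hq.2
    · exfalso
      have hempty := closure_preimage_diff_inter_preimage_singleton_eq_empty π.continuous C hxC
      exact (Set.eq_empty_iff_forall_notMem.mp hempty) q ⟨hq.2, hq.1⟩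

end F75c

end Summit.ResolutionOfSingularities.ResolutionOfSingularities.Theorems

end
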